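import Summits.RiemannHypothesis.RiemannHypothesis.Theorems.JensenPolynomialsSkeletonLaws

/-!
# Route `JensenPolynomials` — rung J-P (P1⁺), TYPED OBJECT: the binomial QUOTIENT sequence `f = r ⋆ s^{⋆−1}` (the named
# perturbation coefficients of the skeleton sign test)

**RH-FREE, ξ-free definitions + their defining identities.** The blueprint / law schema (`skeletonSignTest_of_tables`,
`skeletonSignTestLaw_xi_of_tables`) quantify over «any `f` with `r_n = f ⋆ s_n`». For a planner to TYPE the one remaining far crux
(theory g8 NEXT-RUNG: «a far majorant `Σ_m E_m K_m < 1`») against a NAMED object — as the Hermite route did with `gorttwCoeff` — this file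
defines the canonical quotient:

* `binomQuot r s` — the unique sequence `f` with `r_j = Σ_{i≤j} C(j,i) f_{j−i} s_i` for all `j` when `s₀ = 1`
  (well-founded recursion `f_j = r_j − Σ_{k<j} C(j,k) f_k s_{j−k}`); `binomConv_binomQuot` is that identity;
* `skelQuotSeq γ n := binomQuot (windowSeq γ n) (skeletonSeq γ n)` — the perturbation coefficients of the cell `(·, n)`:
  `m!·[w^m](g_{r_n}/g_{s_n})(w)` in EGF language (the CAL's `F = exp(Σ_{j≥3} Δb_j w^j)`), with `skelQuotSeq γ n 0 = 1` and, under the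
  second-order matching hypotheses, `skelQuotSeq γ n 1 = skelQuotSeq γ n 2 = 0`;
* `skeletonSignTest_xi_of_named_tables` — the blueprint for `ξ` with `f := skelQuotSeq ξ n` (no `∃ f` left): tables
  `E_m ≥ |C(d,m)·skelQuotSeq ξ n m|`, `K_m` as before, `Σ_{m=3}^{d} E_m K_m < 1` ⇒ `SkeletonSignTest ξ d n`.

WHAT THIS IS NOT: no bound on `skelQuotSeq ξ n m` is proved (that is the analytic input, TABLE Z / LEMMA Z′ / the far window laws);
nothing here bears on the truth of RH.
-/

noncomputable section
-- D-0017: `Summit.RiemannHypothesis.RiemannHypothesis.…` duplicates the namespace BY DESIGN (single-problem summit).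
set_option linter.dupNamespace false

namespace Summit.RiemannHypothesis.RiemannHypothesis.Theorems.JensenPolynomials

open Literature.NumberTheory.LFunctions Polynomial Finset
open scoped BigOperators Nat

/-- The **binomial quotient** of two sequences: `binomQuot r s j = r j − Σ_{k<j} C(j,k)·(binomQuot r s k)·s(j−k)`. When `s 0 = 1` it is
the unique `f` with `r = f ⋆ s` binomially (`binomConv_binomQuot`), i.e. the Taylor coefficients·`j!` of the EGF quotient `g_r/g_s`. -/
def binomQuot (r s : ℕ → ℝ) : ℕ → ℝ
  | j => r j - ∑ k : Fin j, ((j.choose (k : ℕ) : ℝ) * binomQuot r s k * s (j - k))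
termination_by j => j
decreasing_by exact k.isLt

/-- The defining recursion of `binomQuot`, with a `Finset.range` sum. -/
theorem binomQuot_eq (r s : ℕ → ℝ) (j : ℕ) :
    binomQuot r s j = r j - ∑ k ∈ range j, (j.choose k : ℝ) * binomQuot r s k * s (j - k) := by
  rw [binomQuot, ← Fin.sum_univ_eq_sum_range]

/-- **`r = (binomQuot r s) ⋆ s`** when `s₀ = 1`: for every `j`, `Σ_{i≤j} C(j,i)·binomQuot r s (j−i)·s i = r j`. -/
theorem binomConv_binomQuot (r s : ℕ → ℝ) (hs0 : s 0 = 1) (j : ℕ) :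
    ∑ i ∈ range (j + 1), (j.choose i : ℝ) * binomQuot r s (j - i) * s i = r j := by
  -- reflect the index: i ↦ j − i
  have hrefl : ∑ i ∈ range (j + 1), (j.choose i : ℝ) * binomQuot r s (j - i) * s i =
      ∑ k ∈ range (j + 1), (j.choose k : ℝ) * binomQuot r s k * s (j - k) := by
    rw [← Finset.sum_range_reflect]
    refine Finset.sum_congr rfl fun k hk => ?_
    have hkj : k ≤ j := Nat.lt_succ_iff.mp (mem_range.mp hk)
    rw [show j + 1 - 1 - k = j - k by omega, show j - (j - k) = k by omega, Nat.choose_symm hkj]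
  rw [hrefl, Finset.sum_range_succ, Nat.choose_self, Nat.cast_one, one_mul, Nat.sub_self, hs0, mul_one, binomQuot_eq]
  ring

/-- `binomQuot r s 0 = r 0`. -/
theorem binomQuot_zero (r s : ℕ → ℝ) : binomQuot r s 0 = r 0 := by
  rw [binomQuot_eq]; simp

/-- The **perturbation coefficients of the skeleton sign test at shift `n`**: `skelQuotSeq γ n = r_n ⋆ s_n^{⋆−1}` (binomial quotient of
the window sequence by the skeleton sequence; EGF: `Σ_m skelQuotSeq γ n m · w^m/m! = g_{r_n}(w)/g_{s_n}(w)`). RH-FREE, ξ-free. -/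
def skelQuotSeq (γ : ℕ → ℝ) (n : ℕ) : ℕ → ℝ :=
  binomQuot (windowSeq γ n) (skeletonSeq γ n)

/-- `r_n = skelQuotSeq γ n ⋆ s_n` (every index; uses `s_n(0) = 1`). -/
theorem windowSeq_eq_binomConv_skelQuotSeq (γ : ℕ → ℝ) (n j : ℕ) :
    windowSeq γ n j = ∑ i ∈ range (j + 1), (j.choose i : ℝ) * skelQuotSeq γ n (j - i) * skeletonSeq γ n i :=
  (binomConv_binomQuot _ _ (skeletonSeq_zero γ n) j).symm

/-- `skelQuotSeq γ n 0 = r_n(0)` (`= 1` for `γ(n) ≠ 0`). -/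
theorem skelQuotSeq_zero (γ : ℕ → ℝ) (n : ℕ) (hn : γ n ≠ 0) : skelQuotSeq γ n 0 = 1 := by
  rw [skelQuotSeq, binomQuot_zero, windowSeq_zero γ n hn]

/-- Second-order matching in the quotient: `skelQuotSeq γ n 1 = 0` for `γ(n), γ(n+1) ≠ 0`. -/
theorem skelQuotSeq_one (γ : ℕ → ℝ) (n : ℕ) (hn : γ n ≠ 0) (hn1 : γ (n + 1) ≠ 0) : skelQuotSeq γ n 1 = 0 :=
  binomConv_coeff_one (windowSeq_eq_binomConv_skelQuotSeq γ n 1) (skelQuotSeq_zero γ n hn) (skeletonSeq_zero γ n)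
    (by rw [windowSeq_one γ n hn hn1, skeletonSeq_one])

/-- Second-order matching in the quotient: `skelQuotSeq γ n 2 = 0` for `γ(n), γ(n+1) ≠ 0` and `κ_n² ≥ 0`. -/
theorem skelQuotSeq_two (γ : ℕ → ℝ) (n : ℕ) (hn : γ n ≠ 0) (hn1 : γ (n + 1) ≠ 0) (hκ : 0 ≤ skelKappaSq γ n) :
    skelQuotSeq γ n 2 = 0 :=
  binomConv_coeff_two (windowSeq_eq_binomConv_skelQuotSeq γ n 2) (skelQuotSeq_zero γ n hn) (skelQuotSeq_one γ n hn hn1)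
    (skeletonSeq_zero γ n) (skeletonSeq_two γ n hκ).symm

/-- **Expansion with the named coefficients**: for `γ(n), γ(n+1) ≠ 0`, `κ_n² ≥ 0`, `d ≥ 2` and every `e`,
`A^d_{r_n}(e) = A^d_{s_n}(e) + Σ_{m=3}^{d} C(d,m)·skelQuotSeq γ n m·A^{d−m}_{s_n}(e)`. -/
theorem eval_appellPoly_windowSeq_eq_skelQuot (γ : ℕ → ℝ) (n d : ℕ) (hd : 2 ≤ d) (hn : γ n ≠ 0) (hn1 : γ (n + 1) ≠ 0)
    (hκ : 0 ≤ skelKappaSq γ n) (e : ℝ) :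
    (appellPoly (windowSeq γ n) d).eval e = (appellPoly (skeletonSeq γ n) d).eval e +
      ∑ m ∈ Ico 3 (d + 1), (d.choose m : ℝ) * skelQuotSeq γ n m * (appellPoly (skeletonSeq γ n) (d - m)).eval e :=
  eval_appellPoly_binomConv_eq hd (fun j _ => windowSeq_eq_binomConv_skelQuotSeq γ n j) (windowSeq_zero γ n hn)
    (skeletonSeq_zero γ n) (by rw [windowSeq_one γ n hn hn1, skeletonSeq_one]) (skeletonSeq_two γ n hκ).symm e

/-- **Blueprint for `ξ` with the NAMED coefficients** (RH-FREE): at a cell `(d, n)`, `d ≥ 2`, tables `E_m ≥ |C(d,m)·skelQuotSeq ξ n m|` and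
`K_m` with `|A^{d−m}_{s_n}(e)| ≤ K_m|A^d_{s_n}(e)|` at the critical points of the skeleton and `Σ_{m=3}^{d} E_m K_m < 1` give
`SkeletonSignTest xiTaylorCoeff d n`. -/
theorem skeletonSignTest_xi_of_named_tables (d n : ℕ) (hd : 2 ≤ d) (E K : ℕ → ℝ)
    (hE : ∀ m ∈ Ico 3 (d + 1), |(d.choose m : ℝ) * skelQuotSeq xiTaylorCoeff n m| ≤ E m)
    (hK : ∀ m ∈ Ico 3 (d + 1), ∀ e : ℝ, (derivative (appellPoly (skeletonSeq xiTaylorCoeff n) d)).eval e = 0 →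
      |(appellPoly (skeletonSeq xiTaylorCoeff n) (d - m)).eval e| ≤
        K m * |(appellPoly (skeletonSeq xiTaylorCoeff n) d).eval e|)
    (hsum : ∑ m ∈ Ico 3 (d + 1), E m * K m < 1) :
    SkeletonSignTest xiTaylorCoeff d n :=
  skeletonSignTest_xi_of_tables d n hd (skelQuotSeq xiTaylorCoeff n)
    (fun j _ => windowSeq_eq_binomConv_skelQuotSeq xiTaylorCoeff n j) E K hE hK hsum

/-- **Law schema for `ξ` with the NAMED coefficients** (RH-FREE): tables on the region `d ≥ 3, n ≥ n₀, p·d³ ≤ q·n` for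
`f = skelQuotSeq ξ n` give `SkeletonSignTestLaw xiTaylorCoeff p q n₀` — the typed consumer shape of a far majorant crux. -/
theorem skeletonSignTestLaw_xi_of_named_tables (p q n₀ : ℕ) (E K : ℕ → ℕ → ℕ → ℝ)
    (hE : ∀ d n : ℕ, 3 ≤ d → n₀ ≤ n → p * d ^ 3 ≤ q * n →
      ∀ m ∈ Ico 3 (d + 1), |(d.choose m : ℝ) * skelQuotSeq xiTaylorCoeff n m| ≤ E d n m)
    (hK : ∀ d n : ℕ, 3 ≤ d → n₀ ≤ n → p * d ^ 3 ≤ q * n →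
      ∀ m ∈ Ico 3 (d + 1), ∀ e : ℝ, (derivative (appellPoly (skeletonSeq xiTaylorCoeff n) d)).eval e = 0 →
        |(appellPoly (skeletonSeq xiTaylorCoeff n) (d - m)).eval e| ≤
          K d n m * |(appellPoly (skeletonSeq xiTaylorCoeff n) d).eval e|)
    (hsum : ∀ d n : ℕ, 3 ≤ d → n₀ ≤ n → p * d ^ 3 ≤ q * n → ∑ m ∈ Ico 3 (d + 1), E d n m * K d n m < 1) :
    SkeletonSignTestLaw xiTaylorCoeff p q n₀ :=
  fun d n hd hn hdn => skeletonSignTest_xi_of_named_tables d n (by omega) (E d n) (K d n) (hE d n hd hn hdn)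
    (hK d n hd hn hdn) (hsum d n hd hn hdn)

end Summit.RiemannHypothesis.RiemannHypothesis.Theorems.JensenPolynomials

end
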